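import Mathlib
import Literature.MathematicalPhysics.KineticTheory.HardSphereEuler
import Literature.MathematicalPhysics.KineticTheory.HardSphereBBGKYLiouvilleFlow
import Summits.AtomisticToContinuum.HydrodynamicLimit.Theses.JParityClosure
import HarnessLib

/-!
# JParityClosure / ParityInBand — helper: tightness of the empirical kinetic energy at every time
# from energy conservation and the `t = 0` law of large numbers

Companion of `JParityClosureParityInBandSmoothTest.lean` (`tendstoHydroFieldsAt_of_isSmooth` needs
the empirical kinetic energy at time `t` to be tight). Along a hard-sphere flow the kinetic energy of
a good initial datum is conserved (`HardSphereFlow.configEnergy_flow`), the local Gibbs law does not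
charge the complement of the good set (it is absolutely continuous with respect to the Liouville
measure), and the `t = 0` hypothesis of the packing-guarded conjunct (`TendstoHydroFieldsAt … 0`,
energy conjunct with `χ = 1`) says that the total empirical energy concentrates at `∫ E(0)`. Hence
at EVERY `t` the total empirical kinetic energy exceeds `∫ E(0) + 1` only with vanishing probability.
-/

namespace Summit.AtomisticToContinuum.HydrodynamicLimit.Theorems

open Set MeasureTheory Filter Topology
open scoped ENNReal
open Literature.MathematicalPhysics.KineticTheory Literature.Analysis.FluidPDE

/-- The empirical energy field tested against `1` is the kinetic energy per particle:
`⟨μ_z, |v|²/2⟩ = (N+1)⁻¹ · ½ ∑ᵢ |vᵢ|²`. [folklore] -/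
theorem empiricalEnergyField_one_eq {N : ℕ} (z : Config (N + 1) (Fin 3) T3) :
    empiricalEnergyField z (fun _ => 1) = (((N + 1 : ℕ) : ℝ))⁻¹ * configEnergy z := by
  simp only [empiricalEnergyField, integral_empiricalMeasure, one_mul, configEnergy,
    Finset.mul_sum]
  refine Finset.sum_congr rfl fun i _ => ?_
  ring

/-- **Conservation of the empirical kinetic energy along the flow** (good initial data).
[folklore] -/
theorem empiricalEnergyField_one_flow {ε : ℝ} {N : ℕ}
    (Φ : HardSphereFlow (Torus.geometry (Fin 3)) ε (N + 1)) {z : Config (N + 1) (Fin 3) T3}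
    (hz : z ∈ Φ.good) (t : ℝ) :
    empiricalEnergyField (Φ.flow t z) (fun _ => 1) = empiricalEnergyField z (fun _ => 1) := by
  rw [empiricalEnergyField_one_eq, empiricalEnergyField_one_eq, Φ.configEnergy_flow hz t]

/-- The local Gibbs law does not charge the bad set of the flow (it has a density with respect to
the Liouville measure, and the good set is Liouville-conull). [folklore] -/
theorem localGibbsLaw_compl_good (σ : ℝ) (a₀ θ₀ : T3 → ℝ) (u₀ : T3 → V3) (N : ℕ)
    (Φ : HardSphereFlow (Torus.geometry (Fin 3)) (hsDiameter σ N) (N + 1)) :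
    localGibbsLaw σ a₀ u₀ θ₀ N Φ Φ.goodᶜ = 0 := by
  rw [localGibbsLaw, particleLaw_eq]
  exact withDensity_absolutelyContinuous _ _ Φ.measure_compl_good

/-- **Tightness of the empirical kinetic energy at every time.** Under the `t = 0` hypothesis of the
packing-guarded conjunct (`TendstoHydroFieldsAt … 0` for the local Gibbs laws), for every `t` and
`η > 0` the total empirical kinetic energy at time `t` exceeds `K = ∫ E(0) + 1` with probability at
most `η` for all large `N` (energy conservation on the good set + the bad set is null). This is
hypothesis (i) of `tendstoHydroFieldsAt_of_isSmooth`. [folklore] -/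
theorem energy_tight_of_tendstoHydroFieldsAt_zero (σ : ℝ) (a₀ θ₀ : T3 → ℝ) (u₀ : T3 → V3)
    (Φ : (N : ℕ) → HardSphereFlow (Torus.geometry (Fin 3)) (hsDiameter σ N) (N + 1))
    (ρ θ : ℝ → T3 → ℝ) (u : ℝ → T3 → V3)
    (h0 : TendstoHydroFieldsAt (fun N => localGibbsLaw σ a₀ u₀ θ₀ N (Φ N)) Φ ρ u θ 0) (t : ℝ) :
    ∀ η : ℝ, 0 < η → ∃ K : ℝ, ∃ N₀ : ℕ, ∀ N, N₀ ≤ N →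
      localGibbsLaw σ a₀ u₀ θ₀ N (Φ N)
        {z | K < empiricalEnergyField ((Φ N).flow t z) (fun _ => 1)} ≤ ENNReal.ofReal η := by
  intro η hη
  obtain ⟨-, -, hE⟩ := h0 (fun _ => (1 : ℝ)) continuous_const 1 one_pos
  set E0 : ℝ := ∫ x, (1 : ℝ) * totalEnergyDensity (ρ 0 x) (u 0 x) (θ 0 x) with hE0
  have hηpos : (0 : ℝ≥0∞) < ENNReal.ofReal η := by rwa [ENNReal.ofReal_pos]
  have hev := (ENNReal.tendsto_nhds_zero.1 hE) (ENNReal.ofReal η) hηpos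
  obtain ⟨N₀, hN₀⟩ := eventually_atTop.1 hev
  refine ⟨E0 + 1, N₀, fun N hN => le_trans (measure_mono fun z hz => ?_) ((measure_union_le
    ((Φ N).goodᶜ) {z | (1 : ℝ) < |empiricalEnergyField ((Φ N).flow 0 z) (fun _ => 1) - E0|}).trans
    ?_)⟩
  · simp only [mem_setOf_eq, mem_union, mem_compl_iff] at hz ⊢
    by_cases hg : z ∈ (Φ N).good
    · right
      rw [empiricalEnergyField_one_flow (Φ N) hg t] at hz
      rw [empiricalEnergyField_one_flow (Φ N) hg 0]
      have : 1 < empiricalEnergyField z (fun _ => 1) - E0 := by linarith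
      exact this.trans_le (le_abs_self _)
    · exact Or.inl hg
  · rw [localGibbsLaw_compl_good, zero_add]
    exact hN₀ N hN

end Summit.AtomisticToContinuum.HydrodynamicLimit.Theorems
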